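import Summits.MatrixMultiplication.OmegaCensus.SmallFormats.KroneckerDualPeel
import Summits.MatrixMultiplication.OmegaCensus.SmallFormats.KroneckerCompanion

/-!
# Kronecker modules VII: the Weierstraß–Kronecker block decomposition (main theorem)

Cell `pub-omega` (unit `pub-omega-tensor-g33`), topic `Summits/MatrixMultiplication/OmegaCensus` (sub-folder `SmallFormats`).
Framing (verbatim): lottery ticket; floor = certified bounds/negative ranges. HONEST FRAMING: general linear algebra; this is
the theorem the derivation of `KroneckerBlockForm97` rests on; nothing on `ω` here.

**Theorem (`kronecker_blockDecomposition`).** Every Kronecker module `a b : U →ₗ[k] V` between finite-dimensional vector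
spaces over a field `k` has a block decomposition (`IsBlockDecomposition`) into Weierstraß–Kronecker blocks `L ε`, `L ηᵀ`,
`N u`, `C c` (`KBlock`, conventions of `PBlock`), all of positive size. Proof by induction on `finrank U + finrank V`:
if the dual module `(bᵀ, aᵀ)` has a chain, a minimal one splits off an `L_ε` block (`dual_peel`); else if `(a, b)` has a
chain, a minimal one splits off an `L_ηᵀ` block (`peel`); else the module is regular on both sides and
`U = Xi ⊕ Yi`, `V = b Xi ⊕ a Yi` (`regular_decomposition`) with `b` bijective on the first pair (companion blocks,
`companion_blockDecomposition`) and `a` bijective with `a⁻¹ b` nilpotent on the second (`N` blocks,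
`nilpotent_blockDecomposition`). Zero-size blocks are filtered at the end (`IsBlockDecomposition.proper`).
-/

namespace Summit.MatrixMultiplication.OmegaCensus.SmallFormats.Kronecker

open Module Submodule

variable {k : Type*} [Field k]

/-! ## Coefficients from an independent family of the right size -/

section Coeffs

variable {U : Type*} [AddCommGroup U] [Module k U]

/-- Zero extension of a `Fin m`-family to `ℕ`. -/
def finExt {m : ℕ} (u : Fin m → U) : ℕ → U := fun r => if h : r < m then u ⟨r, h⟩ else 0

/-- `finExt` on valid indices. -/
theorem finExt_of_lt {m : ℕ} (u : Fin m → U) {r : ℕ} (h : r < m) : finExt u r = u ⟨r, h⟩ := by simp [finExt, h]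

/-- `finExt` at a `Fin` index. -/
@[simp] theorem finExt_fin {m : ℕ} (u : Fin m → U) (i : Fin m) : finExt u i = u i := by simp [finExt, i.2]

/-- An independent family with `finrank U₁` members in `U₁` spans `U₁` with explicit coefficients. -/
theorem exists_coeffs_of_linearIndependent [FiniteDimensional k U] {m : ℕ} (u : Fin m → U) (hli : LinearIndependent k u)
    {U₁ : Submodule k U} (hmem : ∀ i, u i ∈ U₁) (hdim : finrank k U₁ = m) :
    ∀ x ∈ U₁, ∃ g : ℕ → k, x = ∑ r ∈ Finset.range m, g r • finExt u r := by
  have hle : span k (Set.range u) ≤ U₁ := Submodule.span_le.mpr (by rintro _ ⟨i, rfl⟩; exact hmem i)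
  have heq : span k (Set.range u) = U₁ :=
    Submodule.eq_of_le_of_finrank_eq hle (by rw [finrank_span_eq_card hli, Fintype.card_fin, hdim])
  intro x hx
  rw [← heq] at hx
  obtain ⟨cf, rfl⟩ := (Submodule.mem_span_range_iff_exists_fun k).mp hx
  refine ⟨fun r => if h : r < m then cf ⟨r, h⟩ else 0, ?_⟩
  rw [← Fin.sum_univ_eq_sum_range (fun r => (if h : r < m then cf ⟨r, h⟩ else 0) • finExt u r) m]
  exact Finset.sum_congr rfl (fun i _ => by simp [i.2])

end Coeffs

/-! ## Filtering zero-size blocks -/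

section Proper

variable {U V : Type*} [AddCommGroup U] [Module k U] [AddCommGroup V] [Module k V] {a b : U →ₗ[k] V}

/-- A sum over `Fin n` of a function vanishing off `P` is a sum over `{i // P i}` enumerated by `Fin`. -/
theorem sum_eq_sum_subtypeFin {n : ℕ} (P : Fin n → Prop) [DecidablePred P] {M : Type*} [AddCommMonoid M]
    (G : Fin n → M) (hG : ∀ i, ¬ P i → G i = 0) :
    ∑ i, G i = ∑ j : Fin (Fintype.card {i // P i}), G ((Fintype.equivFin {i // P i}).symm j).1 := by
  rw [← Finset.sum_filter_of_ne (p := P) (fun i _ hi => by by_contra h; exact hi (hG i h)),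
    Finset.sum_subtype (Finset.univ.filter P) (p := P) (by simp),
    ← Equiv.sum_comp (Fintype.equivFin {i // P i}).symm]

/-- Dropping the zero-size blocks of a block decomposition. -/
theorem IsBlockDecomposition.proper {n : ℕ} {blk : Fin n → KBlock k} {e : Fin n → ℕ → U} {f : Fin n → ℕ → V}
    (D : IsBlockDecomposition a b blk e f) :
    ∃ (m : ℕ) (blk' : Fin m → KBlock k) (e' : Fin m → ℕ → U) (f' : Fin m → ℕ → V),
      IsBlockDecomposition a b blk' e' f' ∧ ∀ i, 0 < (blk' i).rows + (blk' i).cols := by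
  classical
  let P : Fin n → Prop := fun i => 0 < (blk i).rows + (blk i).cols
  let τ := (Fintype.equivFin {i // P i}).symm
  have hP : ∀ i, ¬ P i → (blk i).rows = 0 ∧ (blk i).cols = 0 := fun i hi => by
    simp only [P, not_lt, Nat.le_zero, Nat.add_eq_zero_iff] at hi; exact hi
  refine ⟨Fintype.card {i // P i}, fun j => blk (τ j).1, fun j => e (τ j).1, fun j => f (τ j).1,
    ⟨?_, ?_, fun u => ?_, fun v => ?_, fun j r hr => D.rel_a _ r hr, fun j r hr => D.rel_b _ r hr⟩, fun j => (τ j).2⟩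
  · rw [← D.rows_eq]; exact (sum_eq_sum_subtypeFin P (fun i => (blk i).rows) (fun i hi => (hP i hi).1)).symm
  · rw [← D.cols_eq]; exact (sum_eq_sum_subtypeFin P (fun i => (blk i).cols) (fun i hi => (hP i hi).2)).symm
  · obtain ⟨g, hg⟩ := D.span_e u
    refine ⟨fun j => g (τ j).1, ?_⟩
    rw [hg]
    exact sum_eq_sum_subtypeFin P (fun i => ∑ r ∈ Finset.range (blk i).rows, g i r • e i r)
      (fun i hi => by rw [(hP i hi).1]; simp)
  · obtain ⟨g, hg⟩ := D.span_f v
    refine ⟨fun j => g (τ j).1, ?_⟩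
    rw [hg]
    exact sum_eq_sum_subtypeFin P (fun i => ∑ c ∈ Finset.range (blk i).cols, g i c • f i c)
      (fun i hi => by rw [(hP i hi).2]; simp)

end Proper

/-! ## The three cases of the induction -/

section Cases

variable {U V : Type*} [AddCommGroup U] [Module k U] [AddCommGroup V] [Module k V]
  [FiniteDimensional k U] [FiniteDimensional k V] (a b : U →ₗ[k] V)

omit [FiniteDimensional k U] [FiniteDimensional k V] in
/-- The shifted Kronecker `δ`-sum: `Σ_{c<D} [c+1 = r] • F c`. -/
theorem sum_delta_smul_succ (D r : ℕ) (F : ℕ → V) :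
    ∑ c ∈ Finset.range D, (if c + 1 = r then (1 : k) else 0) • F c = if 1 ≤ r ∧ r - 1 < D then F (r - 1) else 0 := by
  cases r with
  | zero => simp
  | succ r' =>
      have : ∀ c, (c + 1 = r' + 1) = (c = r') := fun c => by simp
      simp_rw [this, sum_delta_smul]
      simp

/-- **Case A**: a minimal dual chain gives an `L_ε` block plus a decomposition of the rest. -/
theorem case_L {ε : ℕ} {ψ : ℕ → Dual k V} (hψ : IsChain b.dualMap a.dualMap ε ψ) (hψ0 : ψ ≠ 0)
    (hmin : MinimalAt b.dualMap a.dualMap ε)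
    (IH : ∀ (U₂ : Submodule k U) (V₂ : Submodule k V) (h2a : ∀ u ∈ U₂, a u ∈ V₂) (h2b : ∀ u ∈ U₂, b u ∈ V₂),
      finrank k U₂ + finrank k V₂ < finrank k U + finrank k V →
      ∃ (n : ℕ) (blk : Fin n → KBlock k) (e : Fin n → ℕ → U₂) (f : Fin n → ℕ → V₂),
        IsBlockDecomposition (restr a U₂ V₂ h2a) (restr b U₂ V₂ h2b) blk e f) :
    ∃ (n : ℕ) (blk : Fin n → KBlock k) (e : Fin n → ℕ → U) (f : Fin n → ℕ → V), IsBlockDecomposition a b blk e f := by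
  classical
  obtain ⟨U₁, U₂, V₁, V₂, hU, hV, h1a, h1b, h2a, h2b, hdU, hdV, u, v, hu, hv, hui, hvi, hrela, hrelb⟩ :=
    dual_peel hψ hψ0 hmin
  have hlt : finrank k U₂ + finrank k V₂ < finrank k U + finrank k V := by
    have := Submodule.finrank_add_eq_of_isCompl hU
    have := Submodule.finrank_add_eq_of_isCompl hV
    omega
  obtain ⟨n₂, blk₂, e₂, f₂, D₂⟩ := IH U₂ V₂ h2a h2b hlt
  obtain ⟨e₁, f₁, -, -, D₁⟩ := IsBlockDecomposition.single (a := a) (b := b) (KBlock.L ε) h1a h1b (finExt u) (finExt v)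
    (fun r hr => by rw [finExt_of_lt u hr]; exact hu _)
    (fun c hc => by rw [finExt_of_lt v hc]; exact hv _)
    (by simp [KBlock.rows, hdU]) (by simp [KBlock.cols, hdV])
    (exists_coeffs_of_linearIndependent u hui hu hdU)
    (exists_coeffs_of_linearIndependent v hvi hv hdV)
    (fun r hr => by
      simp only [KBlock.rows] at hr
      simp only [KBlock.cols, KBlock.A, sum_delta_smul, show r < ε + 1 by omega, if_true]
      rw [finExt_of_lt u hr, finExt_of_lt v (by omega), hrela]
      rfl)
    (fun r hr => by
      simp only [KBlock.rows] at hr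
      simp only [KBlock.cols, KBlock.B, sum_delta_smul, show r + 1 < ε + 1 by omega, if_true]
      rw [finExt_of_lt u hr, finExt_of_lt v (by omega), hrelb]
      rfl)
  exact ⟨_, _, _, _, D₁.append hU hV D₂⟩

/-- **Case B**: a minimal chain gives an `L_ηᵀ` block plus a decomposition of the rest. -/
theorem case_LT {η : ℕ} {x : ℕ → U} (hx : IsChain a b η x) (hx0 : x ≠ 0) (hmin : MinimalAt a b η)
    (IH : ∀ (U₂ : Submodule k U) (V₂ : Submodule k V) (h2a : ∀ u ∈ U₂, a u ∈ V₂) (h2b : ∀ u ∈ U₂, b u ∈ V₂),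
      finrank k U₂ + finrank k V₂ < finrank k U + finrank k V →
      ∃ (n : ℕ) (blk : Fin n → KBlock k) (e : Fin n → ℕ → U₂) (f : Fin n → ℕ → V₂),
        IsBlockDecomposition (restr a U₂ V₂ h2a) (restr b U₂ V₂ h2b) blk e f) :
    ∃ (n : ℕ) (blk : Fin n → KBlock k) (e : Fin n → ℕ → U) (f : Fin n → ℕ → V), IsBlockDecomposition a b blk e f := by
  classical
  obtain ⟨U', V', h2a, h2b, hU, hV⟩ := peel hx hx0 hmin
  set X := span k (Set.range fun t : Fin (η + 1) => x t) with hXdef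
  set Wb := span k (Set.range fun t : Fin η => b (x t)) with hWdef
  have hXi := linearIndependent_chain hx hx0 hmin
  have hWi := linearIndependent_b_chain hx hx0 hmin
  have hXd : finrank k X = η + 1 := by rw [hXdef, finrank_span_eq_card hXi, Fintype.card_fin]
  have hWd : finrank k Wb = η := by rw [hWdef, finrank_span_eq_card hWi, Fintype.card_fin]
  have h1a : ∀ u ∈ X, a u ∈ Wb := by
    intro u hu
    obtain ⟨cf, rfl⟩ := (Submodule.mem_span_range_iff_exists_fun k).mp hu
    rw [map_sum]
    refine Submodule.sum_mem _ (fun t _ => ?_)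
    rw [map_smul]
    refine Submodule.smul_mem _ _ ?_
    rcases Fin.eq_zero_or_eq_succ t with rfl | ⟨t', rfl⟩
    · simp [hx.head]
    · rw [Fin.val_succ, hx.rel]; exact subset_span ⟨t', rfl⟩
  have h1b : ∀ u ∈ X, b u ∈ Wb := by
    intro u hu
    obtain ⟨cf, rfl⟩ := (Submodule.mem_span_range_iff_exists_fun k).mp hu
    rw [map_sum]
    refine Submodule.sum_mem _ (fun t _ => ?_)
    rw [map_smul]
    refine Submodule.smul_mem _ _ ?_
    rcases Fin.eq_castSucc_or_eq_last t with ⟨t', rfl⟩ | rfl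
    · rw [Fin.val_castSucc]; exact subset_span ⟨t', rfl⟩
    · rw [Fin.val_last, hx.b_last]; exact Submodule.zero_mem _
  have hlt : finrank k U' + finrank k V' < finrank k U + finrank k V := by
    have := Submodule.finrank_add_eq_of_isCompl hU
    have := Submodule.finrank_add_eq_of_isCompl hV
    omega
  obtain ⟨n₂, blk₂, e₂, f₂, D₂⟩ := IH U' V' h2a h2b hlt
  -- the LT block: rows u r = x (η - r), columns v c = b (x (η - 1 - c))
  let uu : ℕ → U := fun r => x (η - r)
  let vv : ℕ → V := fun c => b (x (η - 1 - c))
  obtain ⟨e₁, f₁, -, -, D₁⟩ := IsBlockDecomposition.single (a := a) (b := b) (KBlock.LT η) h1a h1b uu vv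
    (fun r hr => subset_span ⟨⟨η - r, by omega⟩, rfl⟩)
    (fun c hc => by simp only [KBlock.cols] at hc; exact subset_span ⟨⟨η - 1 - c, by omega⟩, rfl⟩)
    (by simp [KBlock.rows, hXd]) (by simp [KBlock.cols, hWd])
    (by
      intro y hy
      obtain ⟨cf, rfl⟩ := (Submodule.mem_span_range_iff_exists_fun k).mp hy
      refine ⟨fun r => finExt cf (η - r), ?_⟩
      simp only [KBlock.rows, uu]
      rw [← Fin.sum_univ_eq_sum_range (fun j => finExt cf (η - j) • x (η - j)) (η + 1)]
      refine Fintype.sum_equiv Fin.revPerm _ _ (fun t => ?_)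
      have ht : η - (η - (t : ℕ)) = t := Nat.sub_sub_self (Nat.le_of_lt_succ t.is_lt)
      simp only [Fin.revPerm_apply, Fin.val_rev, show η + 1 - ((t : ℕ) + 1) = η - t by omega, ht, finExt_fin])
    (by
      intro y hy
      obtain ⟨cf, rfl⟩ := (Submodule.mem_span_range_iff_exists_fun k).mp hy
      refine ⟨fun c => finExt cf (η - 1 - c), ?_⟩
      simp only [KBlock.cols, vv]
      rw [← Fin.sum_univ_eq_sum_range (fun j => finExt cf (η - 1 - j) • b (x (η - 1 - j))) η]
      refine Fintype.sum_equiv Fin.revPerm _ _ (fun t => ?_)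
      have ht : η - 1 - (η - 1 - (t : ℕ)) = t := Nat.sub_sub_self (by have := t.is_lt; omega)
      simp only [Fin.revPerm_apply, Fin.val_rev, show η - ((t : ℕ) + 1) = η - 1 - t by omega, ht, finExt_fin])
    (by
      intro r hr
      simp only [KBlock.rows] at hr
      simp only [KBlock.cols, KBlock.A, sum_delta_smul, uu, vv]
      split_ifs with h
      · rw [show η - r = (η - 1 - r) + 1 by omega, hx.rel]
      · rw [show η - r = 0 by omega, hx.head])
    (by
      intro r hr
      simp only [KBlock.rows] at hr
      simp only [KBlock.cols, KBlock.B, sum_delta_smul_succ, uu, vv]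
      split_ifs with h
      · rw [show η - 1 - (r - 1) = η - r by omega]
      · rw [show η - r = η by omega, hx.b_last])
  exact ⟨_, _, _, _, D₁.append hU hV D₂⟩

/-- **Case C**: a module that is chain-free on both sides decomposes into companion blocks and `N` blocks. -/
theorem case_regular (hF : ChainFree a b) (hF' : ChainFree b.dualMap a.dualMap) :
    ∃ (n : ℕ) (blk : Fin n → KBlock k) (e : Fin n → ℕ → U) (f : Fin n → ℕ → V), IsBlockDecomposition a b blk e f := by
  classical
  obtain ⟨hU, hV, h1a, h2b, hbinj, hainj⟩ := regular_decomposition hF hF'.swap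
  have h1b : ∀ u ∈ Xi a b, b u ∈ (Xi a b).map b := fun u hu => Submodule.mem_map_of_mem hu
  have h2a : ∀ u ∈ Yi a b, a u ∈ (Yi a b).map a := fun u hu => Submodule.mem_map_of_mem hu
  -- companion part: b bijective on (Xi, b Xi)
  have hbij : Function.Bijective (restr b (Xi a b) ((Xi a b).map b) h1b) := by
    constructor
    · intro u u' h
      have h' := congrArg (fun z : (Xi a b).map b => (z : V)) h
      simp only [restr_apply] at h'
      have : (u : U) - u' = 0 := hbinj _ (Submodule.sub_mem _ u.2 u'.2) (by rw [map_sub, h', sub_self])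
      exact Subtype.ext (sub_eq_zero.mp this)
    · rintro ⟨v, hv⟩
      obtain ⟨u, hu, rfl⟩ := Submodule.mem_map.mp hv
      exact ⟨⟨u, hu⟩, rfl⟩
  obtain ⟨n₁, cs, e₁, f₁, D₁⟩ :=
    companion_blockDecomposition (restr a (Xi a b) ((Xi a b).map b) h1a) (restr b (Xi a b) ((Xi a b).map b) h1b) hbij
  -- nilpotent part: a bijective on (Yi, a Yi), g = a⁻¹ b nilpotent
  have habij : Function.Bijective (restr a (Yi a b) ((Yi a b).map a) h2a) := by
    constructor
    · intro u u' h
      have h' := congrArg (fun z : (Yi a b).map a => (z : V)) h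
      simp only [restr_apply] at h'
      have : (u : U) - u' = 0 := hainj _ (Submodule.sub_mem _ u.2 u'.2) (by rw [map_sub, h', sub_self])
      exact Subtype.ext (sub_eq_zero.mp this)
    · rintro ⟨v, hv⟩
      obtain ⟨u, hu, rfl⟩ := Submodule.mem_map.mp hv
      exact ⟨⟨u, hu⟩, rfl⟩
  set α := LinearEquiv.ofBijective _ habij with hα
  let g : Yi a b →ₗ[k] Yi a b := α.symm.toLinearMap ∘ₗ restr b (Yi a b) ((Yi a b).map a) h2b
  have hαg : ∀ u, α (g u) = restr b (Yi a b) ((Yi a b).map a) h2b u := fun u => by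
    show α (α.symm _) = _; rw [LinearEquiv.apply_symm_apply]
  have hg : ∀ u, restr a (Yi a b) ((Yi a b).map a) h2a (g u) = restr b (Yi a b) ((Yi a b).map a) h2b u := hαg
  -- g maps Y (n+1) into Y n, hence g^n kills Y n
  have hgY : ∀ m (u : Yi a b), (u : U) ∈ Y a b m → (g ^ m) u = 0 := by
    intro m
    induction m with
    | zero => intro u hu; rw [Y_zero, Submodule.mem_bot] at hu; rw [pow_zero, Module.End.one_apply]; exact Subtype.ext hu
    | succ m ih =>
        intro u hu
        rw [Y_succ] at hu
        obtain ⟨y, hy, hyu⟩ := Submodule.mem_map.mp hu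
        have hyY : y ∈ Yi a b := Y_le_Yi a b m hy
        have hgu : g u = ⟨y, hyY⟩ := by
          apply α.injective
          rw [hαg]
          apply Subtype.ext
          simp only [restr_apply, hα, LinearEquiv.ofBijective_apply]
          exact hyu.symm
        rw [pow_succ, Module.End.mul_apply, hgu]
        exact ih _ hy
  have hnil : IsNilpotent g := by
    refine ⟨finrank k U, LinearMap.ext fun u => ?_⟩
    rw [LinearMap.zero_apply]
    exact hgY _ u u.2
  obtain ⟨n₂, ms, e₂, f₂, D₂⟩ :=
    nilpotent_blockDecomposition (restr a (Yi a b) ((Yi a b).map a) h2a) (restr b (Yi a b) ((Yi a b).map a) h2b)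
      habij g hg hnil
  exact ⟨_, _, _, _, D₁.append hU hV D₂⟩

end Cases

/-! ## The main theorem -/

/-- Induction on `finrank U + finrank V`. -/
theorem exists_blockDecomposition_aux (N : ℕ) :
    ∀ {U V : Type*} [AddCommGroup U] [Module k U] [AddCommGroup V] [Module k V]
      [FiniteDimensional k U] [FiniteDimensional k V] (a b : U →ₗ[k] V), finrank k U + finrank k V ≤ N →
      ∃ (n : ℕ) (blk : Fin n → KBlock k) (e : Fin n → ℕ → U) (f : Fin n → ℕ → V), IsBlockDecomposition a b blk e f := by
  induction N with
  | zero =>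
      intro U V _ _ _ _ _ _ a b hN
      exact ⟨0, _, _, _, IsBlockDecomposition.empty (by omega) (by omega)⟩
  | succ N ih =>
      intro U V _ _ _ _ _ _ a b hN
      classical
      by_cases hA : ChainFree b.dualMap a.dualMap
      · by_cases hB : ChainFree a b
        · exact case_regular a b hB hA
        · obtain ⟨η, x, hx, hx0, hmin⟩ := exists_minimal_chain hB
          exact case_LT a b hx hx0 hmin (fun U₂ V₂ h2a h2b hlt => ih _ _ (by omega))
      · obtain ⟨ε, ψ, hψ, hψ0, hmin⟩ := exists_minimal_chain hA
        exact case_L a b hψ hψ0 hmin (fun U₂ V₂ h2a h2b hlt => ih _ _ (by omega))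

/-- **Weierstraß–Kronecker block decomposition.** Every Kronecker module `a b : U →ₗ[k] V` (finite-dimensional vector
spaces over a field) has a block decomposition into Weierstraß–Kronecker blocks of positive size. -/
theorem kronecker_blockDecomposition {U V : Type*} [AddCommGroup U] [Module k U] [AddCommGroup V] [Module k V]
    [FiniteDimensional k U] [FiniteDimensional k V] (a b : U →ₗ[k] V) :
    ∃ (n : ℕ) (blk : Fin n → KBlock k) (e : Fin n → ℕ → U) (f : Fin n → ℕ → V),
      IsBlockDecomposition a b blk e f ∧ ∀ i, 0 < (blk i).rows + (blk i).cols := by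
  obtain ⟨n, blk, e, f, D⟩ := exists_blockDecomposition_aux (k := k) _ a b le_rfl
  exact D.proper

end Summit.MatrixMultiplication.OmegaCensus.SmallFormats.Kronecker
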